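import Summits.BirchSwinnertonDyer.BirchSwinnertonDyer.Theorems.PrintX10bHowardRoad
import Summits.BirchSwinnertonDyer.Rank1Residual.X11b.Three.KolyvaginLine
import Summits.BirchSwinnertonDyer.Rank1Residual.X11b.BDPRouteRankOneBookkeeping
import Summits.BirchSwinnertonDyer.Rank1Residual.X11b.KolyvaginBottomPoint
import Literature.NumberTheory.EllipticCurves.HeegnerPointsKolyvaginPrimaryGeneratorProofs
import Literature.NumberTheory.EllipticCurves.Cha2005.ShaStructureIrreducible
import Literature.NumberTheory.EllipticCurves.BSDSelmerCMPConverseHeegnerFieldProofs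
import Literature.NumberTheory.EllipticCurves.HeegnerPointsClassesProofs
import Literature.NumberTheory.EllipticCurves.HeegnerPointsRationalityProofs
import HarnessLib

/-!
# Crux J₃ = `HeegnerDivisibilityX10b` (stmt-BirchSwinnertonDyer-21340) on the HOWARD FRAMES at `p = 3`:
# Heegner points `3^s`-divisible to the FULL Tamagawa depth on every rev-3b X10b frame (`d_K ≡ 1 (8)`,
# `N_E` and `3` split) with `3 ∤ h_K`, from the Heegner-index IDENTITY over `K` (Howard road at 3) and
# the LOWER half of Kolyvagin's structure theorem under irreducibility (Cha 2005 Rmk. 25) — the `p = 3`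
# twin of `PrintX9MultiPrimeHowardFrames.lean` (cell `bsd-print-x9`, prover seat p4, gen 3)

HONEST FRAMING (cell `run/shared/lean/pub/bsd-print-x9/`, D-0131 print tier): THEOREMS ONLY, nothing
booked; J₃ is NOT closed (the frames with `3 ∣ h_K` remain — no mechanism at any image). Every
published input is a named Literature fact BY NAME.

WHAT. J₃'s body (rev 3b, VERBATIM) with ONE extra frame binder `¬ p ∣ NumberField.classNumber K` after
`SatisfiesHeegnerHypothesis p K`: on those frames every derived Heegner point `P_n` (square-free `n` of
Kolyvagin primes of index `≥ s`) is `3^s`-divisible for ALL `s ≤ ord_3 ∏ c_ℓ(E)` — the «`M_∞ ≥ Σ ord_3 c_q`»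
half of the refined Kolyvagin conjecture at `p = 3`, irreducible NON-surjective image (X10b), where NO
printed source exists at ANY image (BCGS Thm. 2: (sur) ∧ `p > 3`; lit DOSSIER §22.2/§24). Mechanism as
at X9: a non-divisible `P_n` at depth `s ≤ t` is a level-`s` certificate ⇒ `2(M₀ − s + 1) ≤ ord_3 #Ш(E/K)`
(Cha's lower half `hChaL`, typed at every odd `p`), against the Howard-road identity
`ord_3 #Ш(E/K) = 2M₀ − 2t` (§1, intrinsic over `K`: Mastella–Zerman Cor. 4.6 at 3 + Yan–Zhu/BCS/CGLS
composite + JSW 3.3.1, all typed at `p ≥ 3`). NO Jetchev at 3, NO carrier-depth stub, NO Kolyvagin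
conjecture. «beyond-print theorem»: YES (modulo the composite flag + `YZ26@3-BF-ERL-Ohta` on hYZ at 3).

References: [BurungaleEtAl2026] Thm. 2; [Cha2005] Thm. 21, Rmk. 25; [MatarNekovar2019] Thm. 0.7, §0.9–0.11;
[McCallumLMS1991] §5; [MastellaZerman2026] Cor. 4.6; [YanZhu2024MainConjNonCM] Thm. 5.7 (1), 5.9;
[BurungaleCastellaSkinner2025] Prop. 4.2.2; [CastellaGrossiLeeSkinner2022] Thm. 5.1.3;
[JetchevSkinnerWan2017] Thm. 3.3.1; route file `Theses/PrintX10b.lean` (rev 3b, item 21340).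
-/

set_option linter.dupNamespace false
set_option autoImplicit false

noncomputable section

open scoped Classical MatrixGroups ModularForm

open CongruenceSubgroup WeierstrassCurve NumberField IsDedekindDomain
  Literature.NumberTheory.EllipticCurves Literature.NumberTheory.EllipticCurves.ModularForms
  Literature.NumberTheory.EllipticCurves.JetchevSkinnerWan2017
  Literature.NumberTheory.EllipticCurves.YanZhu2026
  Summit.BirchSwinnertonDyer.BirchSwinnertonDyer.Theorems.Rank1ResidualX1Defs
  Summit.BirchSwinnertonDyer.Rank1Residual
  Summit.BirchSwinnertonDyer.Rank1Residual.X11b.Three.Koly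
  Summit.BirchSwinnertonDyer.Rank1Residual.X11b.KolyvaginBottom

open Literature.NumberTheory.EllipticCurves.Rank1Residual (ClassX10 Surj)

namespace Summit.BirchSwinnertonDyer.BirchSwinnertonDyer.Rank1Residual

/-! ### §1 The Heegner-index identity over `K`, intrinsic form, X10b at `p = 3` -/

/-- **The Heegner-index identity over `K` at a Manin-unit Heegner datum of a NON-CM X10b pair (`p = 3`,
`E[3]` irreducible, `ρ̄_{E,3}` not onto) over a Heegner field with `3` split, `d_K` odd `< −4`, `3 ∤ h_K`,
whose Heegner point `P` has INFINITE ORDER** — intrinsic over `K` (rank one and finiteness by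
Kolyvagin, `hKo`). Inputs: Mastella–Zerman Cor. 4.6 at 3 (`h46`, via `X10.heegnerContainment_of_cor46_of_not_surj`),
the composite (`hYZ`), JSW 3.3.1 (`h331`); (irr_K) by the Matar–Nekovář theorem. The `p = 3` twin of
`X9.indexIdentityAt_of_heegnerPoint_of_cor46_of_thm331`.
[cite: MastellaZerman2026, Cor. 4.6] [cite: YanZhu2024MainConjNonCM, Thm. 5.7 (1), Thm. 5.9]
[cite: BurungaleCastellaSkinner2025, Prop. 4.2.2] [cite: CastellaGrossiLeeSkinner2022, Thm. 5.1.3]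
[cite: JetchevSkinnerWan2017, Thm. 3.3.1, §7.3.1 (eq:tamK)] [cite: Kolyvagin1990, Thm. A]
[cite: GrossLMS1991, §2 Conj. (2.2)] -/
theorem X10.indexIdentityAt_of_heegnerPoint_of_cor46_of_thm331_of_not_surj
    (h46 : MastellaZerman2026.cor46_howardDivisibility_of_scalarImage.{0})
    (hYZ : thm57_thm59_bcs422_cgls513_generator_constantCoeff_of_heegnerDivisibility)
    (h331 : thm331_anticyclotomicControl)
    (W : WeierstrassCurve ℚ) [W.IsElliptic] [W.IsGloballyMinimal] [NeZero (W.conductorNorm ℤ)]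
    (p : ℕ) [Fact p.Prime] (hX : ClassX10 W p) (hns : ¬ Surj W 3) (hcm : ¬ W.HasCM)
    (K : Type) [Field K] [NumberField K] (hKo : kolyvagin (W.conductorNorm ℤ) W K)
    (hK : IsImaginaryQuadratic K) (hodd : Odd (NumberField.discr K)) (hlt : NumberField.discr K < -4)
    (hHN : SatisfiesHeegnerHypothesis (W.conductorNorm ℤ) K) (hHp : SatisfiesHeegnerHypothesis p K)
    (hhK : ¬ p ∣ NumberField.classNumber K)
    (Dt : ModularParametrizationData W (W.conductorNorm ℤ))
    (H : HeegnerDatum (W.conductorNorm ℤ) (NumberField.discr K)) (ιC : K →+* ℂ)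
    (P : (W.baseChange K).toAffine.Point)
    (hP : WeierstrassCurve.Affine.Point.map ιC.toRatAlgHom P = heegnerPointComplex Dt H)
    (hPinf : ¬ IsOfFinAddOrder P) (hc : ¬ (p : ℤ) ∣ Dt.c) : X11b.IndexIdentityAt W p K P := by
  obtain ⟨hp3, hord, hirr, -⟩ := id hX
  subst hp3
  have hpP : (3 : ℕ).Prime := Fact.out
  have hp2 : (3 : ℕ) ≠ 2 := by norm_num
  have h3 : NumberField.discr K ≠ -3 := by omega
  have h4 : NumberField.discr K ≠ -4 := by omega
  -- rank one and finiteness over `K` (Kolyvagin, from the non-torsion Heegner point)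
  obtain ⟨hrk, hshaK⟩ := hKo hK hHN ⟨Dt, H, ιC, hP⟩ hPinf
  haveI : Finite (W.baseChange K).sha := hshaK
  have hfinp : Finite (AddCommGroup.primaryComponent (W.baseChange K).sha 3) :=
    Finite.of_injective _ Subtype.val_injective
  -- (irr_K) at this field (Matar–Nekovář Prop. 5.26 (2), a tree theorem)
  have hirrK : (W.baseChange K).HasIrreducibleModPGaloisRep 3 :=
    MatarNekovar2019.prop526_hasIrreducibleModPGaloisRep_baseChange_holds W K hK.1
      (Literature.SatisfiesHeegnerHypothesis.coprime_discr hK.1 hHN) 3 hp2 hirr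
  -- the anticyclotomic datum and the embedding at a prime above `3`
  obtain ⟨κ, γ, 𝔭, hκ, hγ, h𝔭⟩ := X11b.exists_anticyclotomic_generator_prime (p := 3) hK
  haveI : Fact (κ.IsTopGenerator γ) := ⟨hγ⟩
  have hsplit : X11b.SplitsIn K 3 := hHp 3 Fact.out (dvd_refl 3)
  obtain ⟨he, hf⟩ := X11b.degreeOne_of_splitsIn hK.1 hsplit h𝔭
  set ι : K →+* ℚ_[3] := X11b.embAt K 3 𝔭 h𝔭 he hf with hι
  have hCTL : X11b.ControlOnTreeGoodAt 3 κ (X11b.inducedPlace ι) γ ι P :=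
    X11b.controlOnTreeGoodAt_of_thm331_of_inducedPlace h331 le_rfl hord.1 hK hHp rfl hHN hirrK ι
      κ hκ γ hrk hfinp P hPinf
  have hHow := X10.heegnerContainment_of_cor46_of_not_surj h46 hX hns hcm hK h3 h4 hHN hHp hhK κ hκ γ
    hγ Dt H ιC
  have hIW : X11b.IMCWaldspurgerOnTreeGoodAt 3 κ (X11b.inducedPlace ι) γ ι P :=
    X11b.imcWaldspurgerOnTreeGoodAt_inducedPlace_of_heegnerContainment_of_thm331 hYZ h331 le_rfl
      hord hK hodd h3 rfl hHN hHp hirrK hhK ι κ hκ γ Dt hc H ιC P hP hrk hfinp hPinf hHow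
  exact X11b.indexIdentityAt_of_onTreeGoodLinks_of_allSplit hK rfl hHN hIW hCTL

/-! ### §2 J₃ on the Howard frames at `p = 3`, from named facts -/

/-- **J₃ = `HeegnerDivisibilityX10b` (item 21340, rev 3b body VERBATIM) with ONE extra frame binder
`3 ∤ h_K`, from named facts (bound `B = 4`):** on every rev-3b X10b Heegner frame (`d_K ≡ 1 (mod 8)`,
`N_E` and `3` split) with `3 ∤ h_K`, every derived Heegner point is `3^s`-divisible for ALL
`s ≤ ord_3 ∏ c_ℓ(E)` — the «`M_∞ ≥ Σ ord_3 c_q`» half of the refined Kolyvagin conjecture at `p = 3`,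
irreducible non-surjective image. Proof = the `p = 3` twin of `multiPrime_oddCoprimeFrames_of_namedFacts`
(Cha's LOWER half `hChaL` vs the identity of §1; `d_K` odd from `d_K ≡ 1 (8)`). Inputs BY NAME: `h46`,
`hYZ`, `h331`, `hChaL`, Kolyvagin Thm. A (`hKo`), Shimura reciprocity at conductor `1` (`hrec`). NO
Jetchev, NO Kolyvagin conjecture, NO carrier-depth stub.
[cite: BurungaleEtAl2026, Thm. 2 (under (sur), p > 3)] [cite: Cha2005, Thm. 21 and Rmk. 25]
[cite: MatarNekovar2019, Thm. 0.7, §0.9, §0.11] [cite: MastellaZerman2026, Cor. 4.6]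
[cite: YanZhu2024MainConjNonCM, Thm. 5.7 (1), Thm. 5.9] [cite: JetchevSkinnerWan2017, Thm. 3.3.1] -/
theorem heegnerDivisibilityX10b_coprimeFrames_of_namedFacts
    (h46 : MastellaZerman2026.cor46_howardDivisibility_of_scalarImage.{0})
    (hYZ : thm57_thm59_bcs422_cgls513_generator_constantCoeff_of_heegnerDivisibility)
    (h331 : thm331_anticyclotomicControl)
    (hChaL : Cha2005.rmk25_pow_dvd_card_sha_primary_of_certificate)
    (hKo : ∀ (N : ℕ) [NeZero N] (W : WeierstrassCurve ℚ) (K : Type) [Field K] [NumberField K],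
      kolyvagin N W K)
    (hrec : ∀ (N : ℕ) [NeZero N] (W : WeierstrassCurve ℚ) (K : Type) [Field K] [NumberField K],
      heegnerPointOfConductor_one_galoisConj N W K) :
    ∀ (W : WeierstrassCurve ℚ) [W.IsElliptic] [W.IsGloballyMinimal] [NeZero (W.conductorNorm ℤ)] (p : ℕ)
      [Fact p.Prime], ClassX10 W p → ¬ Surj W 3 → ¬ W.HasCM → W.analyticRank = 1 →
      ∃ B : ℕ, ∀ (K : Type) [Field K] [NumberField K]
        (Dt : ModularParametrizationData W (W.conductorNorm ℤ)) (β : ℤ) (ι : K →+* ℂ),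
        IsImaginaryQuadratic K → B < (NumberField.discr K).natAbs → NumberField.discr K % 8 = 1 →
        SatisfiesHeegnerHypothesis (W.conductorNorm ℤ) K → SatisfiesHeegnerHypothesis p K →
        ¬ p ∣ NumberField.classNumber K →
        (4 * (W.conductorNorm ℤ : ℤ)) ∣ β ^ 2 - NumberField.discr K → ¬ (p : ℤ) ∣ Dt.c →
        ∀ (d₁ : KolyvaginHeegnerData Dt β ι 1), ¬ IsOfFinAddOrder d₁.derivedPoint →
        ∀ (s : ℕ), s ≤ padicValNat p W.tamagawaProduct →
        ∀ (n : ℕ) (d : KolyvaginHeegnerData Dt β ι n), Squarefree n →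
          (∀ ℓ ∈ n.primeFactors, Zhang2014.IsKolyvaginPrime (W.conductorNorm ℤ) W K p ℓ ∧
            s ≤ Zhang2014.kolyvaginIndex W p ℓ) →
          ∃ Q : (W.baseChange (ringClassField K ι n)).toAffine.Point,
            ((p ^ s : ℕ) : ℤ) • Q = d.derivedPoint := by
  intro W _ _ _ p _ hX hns hcm _
  obtain ⟨hp3, hordW, hirr, -⟩ := id hX
  subst hp3
  refine ⟨4, ?_⟩
  intro K _ _ Dt β ι hK hBK hd8 hHN hHp hhK hβ hc d₁ hd₁ s hs n d hn hℓ
  have hodd : Odd (NumberField.discr K) := Int.odd_iff.mpr (by omega)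
  have hpP : (3 : ℕ).Prime := Fact.out
  have hp2 : (3 : ℕ) ≠ 2 := by norm_num
  have hneg : NumberField.discr K < 0 := IsImaginaryQuadratic.discr_neg hK
  have hlt : NumberField.discr K < -4 := by omega
  have h3 : NumberField.discr K ≠ -3 := by omega
  have h4 : NumberField.discr K ≠ -4 := by omega
  have hpd : ¬ ((3 : ℕ) : ℤ) ∣ NumberField.discr K :=
    Literature.SatisfiesHeegnerHypothesis.not_dvd_discr hK.1 hHp hpP (dvd_refl 3)
  have hpN : ¬ 3 ∣ W.conductorNorm ℤ := fun h ↦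
    (W.dvd_conductorNorm_iff_not_hasGoodReductionAtPrime 3).mp h hordW.1
  have hpN2 : ¬ 3 ^ 2 ∣ W.conductorNorm ℤ := fun h ↦ hpN (dvd_trans (dvd_pow_self 3 two_ne_zero) h)
  -- depth `0` is trivial
  rcases Nat.eq_zero_or_pos s with rfl | hs1
  · exact ⟨d.derivedPoint, by rw [pow_zero, Nat.cast_one, one_zsmul]⟩
  -- the oriented Heegner datum of the frame and THE Heegner point `y_K ∈ E(K)`
  obtain ⟨H, hHβ⟩ := exists_heegnerDatum (W.conductorNorm ℤ) hneg hβ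
  obtain ⟨P, hP⟩ := heegnerPointComplex_mem_range_map_holds (W.conductorNorm ℤ) W K hK hHN Dt H ι
  have hPd : d₁.toGeomPoints d₁.derivedPoint = toGeomPoints (W.baseChange K) P :=
    toGeomPoints_derivedPoint_one_eq (hrec _ W K) hK hHN hP d₁ hHβ
  have hPinf : ¬ IsOfFinAddOrder P := fun hfin ↦
    hd₁ ((isOfFinAddOrder_derivedPoint_one_iff (hrec _ W K) hK hHN hP d₁ hHβ).mpr hfin)
  -- the identity over `K` at this frame (Howard road, intrinsic form)
  have hid := X10.indexIdentityAt_of_heegnerPoint_of_cor46_of_thm331_of_not_surj h46 hYZ h331 W 3 hX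
    hns hcm K (hKo _ W K) hK hodd hlt hHN hHp hhK Dt H ι P hP hPinf hc
  -- rank one and finiteness over `K` (Kolyvagin), no `p`-torsion (irreducibility)
  obtain ⟨hrank, hshaK⟩ := hKo (W.conductorNorm ℤ) W K hK hHN ⟨Dt, H, ι, hP⟩ hPinf
  haveI : Finite (W.baseChange K).sha := hshaK
  haveI hfinp : Finite (AddCommGroup.primaryComponent (W.baseChange K).sha 3) :=
    Finite.of_injective _ Subtype.val_injective
  have hbot := torsionBy_eq_bot_of_isImaginaryQuadratic_of_hasIrreducibleModPGaloisRep W K hK hpP hirr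
  have hiv : ∀ x : (W.baseChange K).toAffine.Point, 3 • x = 0 → x = 0 := fun x hx ↦ by
    have hmem : x ∈ AddSubgroup.torsionBy (W.baseChange K).toAffine.Point (((3 : ℕ) : ℕ) : ℤ) := by
      rw [mem_torsionBy_iff, natCast_zsmul]
      exact hx
    rw [hbot] at hmem
    exact hmem
  -- the exponent `p^{M₀} ∥ y_K` in `E(K)` and `ord_p [E(K):ℤy_K] = M₀` (McCallum Lemma 5.1)
  haveI : Module.Finite ℤ (W.baseChange K).toAffine.Point := (W.baseChange K).module_finite_point_holds
  obtain ⟨M₀, x₀, hx₀, hmax⟩ := exists_pow_smul_eq_and_forall_ne hPinf (p := 3) hpP.two_le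
  have hdiv : ∃ Q : (W.baseChange K).toAffine.Point, ((3 ^ M₀ : ℕ) : ℤ) • Q = P :=
    ⟨x₀, by rw [natCast_zsmul]; exact hx₀⟩
  have hndiv : ¬ ∃ Q : (W.baseChange K).toAffine.Point, ((3 ^ (M₀ + 1) : ℕ) : ℤ) • Q = P := by
    rintro ⟨Q, hQ⟩
    exact hmax Q (by rw [← natCast_zsmul]; exact hQ)
  haveI : Finite (AddCommGroup.torsion (W.baseChange K).toAffine.Point) :=
    WeierstrassCurve.finite_torsion_point (W := W.baseChange K)
  obtain ⟨c, Q, hcQ, hcker⟩ := X11b.RankOne.exists_coord_of_mordellWeilRank_eq_one (W.baseChange K) hrank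
  have hidx : padicValNat 3 (AddSubgroup.zmultiples P).index = M₀ :=
    padicValNat_index_zmultiples_eq_of_divisibility c Q hcQ hcker hiv P hdiv hndiv
  -- suppose `P_n ∉ 3^s E(K_n)`: a level-`s` certificate; Cha's LOWER half bounds `#Ш` from below
  by_contra hQ
  have hcert := hChaL W hcm K hK h3 h4 hHN 3 hp2 hpd hpN2 hirr Dt β ι d₁ P hPd hPinf M₀
    hdiv hndiv n (s - 1) d hn
    (fun ℓ hℓ' ↦ ⟨(hℓ ℓ hℓ').1, by have := (hℓ ℓ hℓ').2; omega⟩)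
    (by rw [Nat.sub_add_cancel hs1]; exact hQ)
  have hle : 2 * (M₀ - (s - 1)) ≤
      padicValNat 3 (Nat.card (AddCommGroup.primaryComponent (W.baseChange K).sha 3)) :=
    (padicValNat_dvd_iff_le Nat.card_pos.ne').mp hcert
  rw [padicValNat_card_addPrimaryComponent (A := (W.baseChange K).sha) 3] at hle
  -- the identity: `2t + ord_p #Ш(E/K) = 2M₀`
  unfold X11b.IndexIdentityAt at hid
  rw [WeierstrassCurve.shaOrder, hidx] at hid
  omega

end Summit.BirchSwinnertonDyer.BirchSwinnertonDyer.Rank1Residual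

end
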